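import Summits.KontsevichZagierPeriods.KontsevichZagierPeriods.Theses.TorsionLogs
import Summits.KontsevichZagierPeriods.KontsevichZagierPeriods.Theorems.TorsionLogsNeronTorsionSector
import Literature.NumberTheory.Transcendental.KZKernelConjectureForms

/-!
# Crux `TorsionSectorComplete` (stmt-KontsevichZagierPeriods-14212) — line `NeronTorsionAcnodal`
# (forward generator G1 `next-rung` over the floor `NeronTorsionPrimitiveChain`, unit fwd2-rung-KontsevichZagierPeriods-01, gen 9)

Route `TorsionLogs` (route-KontsevichZagierPeriods-TorsionLogs; `closes (h₁ : NeronTorsionSector)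
(h₂ : TorsionSectorComplete) : KontsevichZagierPeriods`; `h₁` CLOSED by the landed translation chain
`NeronTorsionSector_of = NeronTorsionSector_of_primitiveChain stub_assembly`, `h₂` the open residual).

## The rung: ACROSS THE DISCRIMINANT (the acnodal degeneration)

The floor `stub_assembly : NeronTorsionPrimitiveChain` (seed g1-KontsevichZagierPeriods-17981; tied form = the closed crux
`NeronTorsionSector`, stmt-14500) realises by an explicit chain of KZ moves the Néron–torsion identity
`q²·I(P) + p²·(η₁ω₁/2) = c·log B` for a real Weierstrass curve `y² = f(x) = 4x³ − g₂x − g₃` with `Δ = g₂³ − 27g₃² ≠ 0`,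
largest root `e₁ > 0`, and a real `N`-torsion point `P` of the identity component (`N·u_P = a·ω₁`, `p/q = 1/2 − a/N`).
All eight forward lines filed over this floor (gens 1–8: shifted carrier, two corners, duplication, oval, distribution,
addition, pinned height, complex torsion) keep `Δ ≠ 0`.  THE ONE MOVE of this rung (F1, hypothesis generalised): the
hypothesis `g₂ ^ 3 - 27 * g₃ ^ 2 ≠ 0` becomes `ok (g₂ ^ 3 - 27 * g₃ ^ 2)` for an ARBITRARY predicate `ok : ℝ → Prop`
(family `NeronTorsionSectorOn ok`); the rung `NeronTorsionAcrossDiscriminant := ∀ ok, NeronTorsionSectorOn ok` is the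
floor's statement with that hypothesis DELETED (`acrossDiscriminant_iff_free`), its member `ok = (· ≠ 0)` is the floor's crux
VERBATIM (`neronTorsionSectorOn_ne_iff`, `Iff.rfl`), and its new content is the member `ok = (· = 0)`: the singular
cubics.  Under the floor's remaining hypotheses (`f e₁ = 0`, `0 < e₁`, `f > 0` beyond `e₁`, a real point of order
`N ≥ 3` with the analytic datum `N·∫_(x_P)^∞ dx/√f = a·2∫_(e₁)^∞ dx/√f`) a cubic with `Δ = 0` is forced to be the
ACNODAL cubic `f = 4x³ − 3e₁²x − e₁³ = 4(x + e₁/2)²(x − e₁)` (node at `x = −e₁/2` off the one-dimensional real locus,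
`E_ns(ℝ) ≅ S¹`, real points of every order; the split node `f = 4(x − e₁)²(x + 2e₁)` is excluded because
`∫_(e₁)^∞ dx/√f` diverges there while `∫_(x_P)^∞ dx/√f > 0`).  On it the substitution `x = e₁ + s²` rationalises
everything: `dx/√f = ds/(s² + c²)` with `c² = 3e₁/2`, `ω₁ = π/c`, `s_P = c·cot(aπ/N)`, and (planner's computation,
`compute/acnodal_check.py`, 7 instances to ≤ 2·10⁻¹², x-coordinate cross-check 2·10⁻¹³)

  `I(P) = log sec(pπ/q) − ζ(2)·ρ²`,   `rP.value = (ω₁/2)·η₁^reg = π²/6 = ζ(2)` for EVERY acnodal cubic,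
  hence  `q²·I(P) + p²·ζ(2) = q²·log sec(pπ/q)`   (`ρ = p/q = 1/2 − a/N`, `sec(pπ/q) = csc(aπ/N)`):

the Néron–torsion identity is CONTINUOUS ACROSS `Δ = 0`, its quasi-period product degenerating to `ζ(2)` and its
logarithm to `log csc(aπ/N)` (e.g. `y² = 4x³ − 3x − 1`, `P = (5/2, 3√6)` of order 4: `16·I(P) + ζ(2) = 8 log 2`;
`P = (3/2, 2√2)` of order 3: `36·I(P) + ζ(2) = 36 log(2/√3)`).

WHY THE FLOOR'S PROOF STOPS: `stub_gridData` / `stub_realDictionary` (TorsionLogsNeronTorsionSectorStubGridData.lean,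
…StubRealDictionary.lean) build the translation grid `x_k = ℘(kω₁/n)` from the LATTICE with invariants `(g₂, g₃)` —
there is no lattice at `Δ = 0` (`hΔ` is consumed by `stub_gridData` in TorsionLogsNeronTorsionSectorAssemblyMain.lean).
NEW INPUT (stubs A–C): the trigonometric dictionary `x = e₁ + (3e₁/2)tan² φ` (`dx/√f = dφ/c`) and a PLANAR SCISSORS
CONGRUENCE under the rotation group with algebraic angles for the quadratic term — `q²•[T_L, dφ′dφ/3] ∼ p²•[Q, 2dφ′dφ/3]`
(`L = pπ/q`, `Q = (0, π/2)²`) via `[T_L] ∼ 2•[S_(L/2)]` (cuts, one swap, translations) and the tilings of `S_(L/2)` and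
`Q` by `p²`, resp. `q²`, translates of `S_(π/2q)`; NO division in `FormalRep` (the saturation trap of the sibling lines
is avoided because the arc of `P` has angle exactly `pπ/q` and the coefficient `q²` is available) and NO transcendental
primitive (`arctan` is never integrated: the catalogued `AlgebraicPrimitivesObstruction` is evaded exactly as the floor
evades it, by algebraic self-maps of the curve — here the rotations of the circle `E_ns(ℝ)⁰`).

Statements below are written over existing declarations only (`KZ.IntegralRep`, `KZ.of`, `KZ.relations`, Mathlib's
`WeierstrassCurve.Affine.Point`, `addOrderOf` — Mathlib's group law is on the NONSINGULAR points of an arbitrary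
Weierstrass curve, so the member `Δ = 0` is typed by the floor's own text).
[cite: KontsevichZagier2001, §1.2] [cite: Lang1983, Ch. 13 Thm 1.1] [cite: SilvermanATAEC1994, VI Thm 3.2, Ex. 6.4]
-/

noncomputable section

open Set MeasureTheory Filter Topology
open Literature.NumberTheory.Transcendental Literature.ModelTheory.ExponentialFields
open Summit.KontsevichZagierPeriods.KontsevichZagierPeriods.Theses.TorsionLogs (NeronTorsionSector NeronTorsionPrimitiveChain
  TorsionSectorComplete)
open Summit.KontsevichZagierPeriods.HyperbolicBloch.OffTetraSectorKernel (exists_logRep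
  interval_log_relation_mem_relations hermiteLindemann_evalP_log)
open Summit.KontsevichZagierPeriods.KontsevichZagierPeriods.Cruxes.NeronTorsionSector.Translation (logRep_value
  isAlgebraic_of_logRep NeronTorsionSector_of_primitiveChain stub_assembly NeronTorsionSector_of)

-- `Summit.KontsevichZagierPeriods.KontsevichZagierPeriods.…` is the tree's mandated layout (single-conjunct summit).
set_option linter.dupNamespace false

namespace Summit.KontsevichZagierPeriods.KontsevichZagierPeriods.Cruxes.TorsionSectorComplete.NeronTorsionAcnodal

/-! ### Statements -/

/-- **The family.** The tied Néron–torsion sector of the route (`Theses.TorsionLogs.NeronTorsionSector`, stmt-14500,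
closed) with its discriminant hypothesis `g₂ ^ 3 - 27 * g₃ ^ 2 ≠ 0` replaced by `ok (g₂ ^ 3 - 27 * g₃ ^ 2)` for a
predicate `ok : ℝ → Prop`; everything else VERBATIM.  Member `(· ≠ 0)` = the floor; member `(· = 0)` = the acnodal
cubics; member `fun _ => True` = the hypothesis deleted. [cite: KontsevichZagier2001, §1.2] -/
def NeronTorsionSectorOn (ok : ℝ → Prop) : Prop :=
  ∀ (g₂ g₃ e₁ xP yP α : ℝ) (N a : ℕ) (M k m : ℤ) (f : ℝ → ℝ), (∀ x, f x = 4 * x ^ 3 - g₂ * x - g₃) → ok (g₂ ^ 3 - 27 * g₃ ^ 2) → f e₁ = 0 → 0 < e₁ → (∀ x, e₁ < x → 0 < f x) → e₁ < xP → yP ^ 2 = f xP → 3 ≤ N → 0 < a → 2 * a < N → 4 * (N : ℤ) ^ 2 * k = M * ((N : ℤ) - 2 * (a : ℤ)) ^ 2 → (∀ hns : (⟨0, 0, 0, -g₂ / 4, -g₃ / 4⟩ : WeierstrassCurve ℝ).toAffine.Nonsingular xP (yP / 2), addOrderOf (WeierstrassCurve.Affine.Point.some xP (yP / 2) hns) =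 N) → (N : ℝ) * (∫ x in Set.Ioi xP, (Real.sqrt (f x))⁻¹) = a * (2 * ∫ x in Set.Ioi e₁, (Real.sqrt (f x))⁻¹) → 1 < α → ∀ (rI rP : Literature.NumberTheory.Transcendental.KZ.IntegralRep 2) (rL : Literature.NumberTheory.Transcendental.KZ.IntegralRep 1), rI.domain = {z | e₁ < z 1 ∧ z 1 < z 0 ∧ z 0 < xP} → Set.EqOn rI.integrand (fun z => z 1 / (Real.sqrt (f (z 1)) * Real.sqrt (f (z 0)))) rI.domain → rP.domain = {z | e₁ < z 0 ∧ e₁ < z 1} → Set.EqOn rP.integrand (fun z => (Real.sqrt (f (z 0)))⁻¹ * ((g₂ * z 1 + 2 * g₃) / (2 * (z 1) ^ 2 * Real.sqrt (f (z 1))))) rP.domain → rL.domain = {t | 1 < t 0 ∧ t 0 < α} → Set.EqOn rL.integrand (fun t => (t 0)⁻¹) rL.domain → (M : ℝ) * rI.value + k * rP.value = m * rL.value → M • Literature.NumberTheory.Transcendental.KZ.of rI + k • Literature.NumberTheory.Transcendental.KZ.of rP - m • Literature.NumberTheory.Transcendental.KZ.of rL ∈ Literature.NumberTheory.Transcenden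tal.KZ.relations

/-- **THE RUNG.** The tied Néron–torsion sector ACROSS THE DISCRIMINANT: every member of the family, i.e. the floor's
crux with the hypothesis `Δ ≠ 0` deleted (`acrossDiscriminant_iff_free`). [cite: KontsevichZagier2001, §1.2] -/
def NeronTorsionAcrossDiscriminant : Prop := ∀ ok : ℝ → Prop, NeronTorsionSectorOn ok

/-- The floor's crux with the discriminant hypothesis deleted outright (for `acrossDiscriminant_iff_free`). -/
def NeronTorsionSectorFree : Prop :=
  ∀ (g₂ g₃ e₁ xP yP α : ℝ) (N a : ℕ) (M k m : ℤ) (f : ℝ → ℝ), (∀ x, f x = 4 * x ^ 3 - g₂ * x - g₃) → f e₁ = 0 → 0 < e₁ → (∀ x, e₁ < x → 0 < f x) → e₁ < xP → yP ^ 2 = f xP → 3 ≤ N → 0 < a → 2 * a < N → 4 * (N : ℤ) ^ 2 * k = M * ((N : ℤ) - 2 * (a : ℤ)) ^ 2 → (∀ hns : (⟨0, 0, 0, -g₂ / 4, -g₃ / 4⟩ : WeierstrassCurve ℝ).toAffine.Nonsingular xP (yP / 2), addOrderOf (WeierstrassCurve.Affine.Point.some xP (yP / 2) hns) = N) → (N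 : ℝ) * (∫ x in Set.Ioi xP, (Real.sqrt (f x))⁻¹) = a * (2 * ∫ x in Set.Ioi e₁, (Real.sqrt (f x))⁻¹) → 1 < α → ∀ (rI rP : Literature.NumberTheory.Transcendental.KZ.IntegralRep 2) (rL : Literature.NumberTheory.Transcendental.KZ.IntegralRep 1), rI.domain = {z | e₁ < z 1 ∧ z 1 < z 0 ∧ z 0 < xP} → Set.EqOn rI.integrand (fun z => z 1 / (Real.sqrt (f (z 1)) * Real.sqrt (f (z 0)))) rI.domain → rP.domain = {z | e₁ < z 0 ∧ e₁ < z 1} → Set.EqOn rP.integrand (fun z => (Real.sqrt (f (z 0)))⁻¹ * ((g₂ * z 1 + 2 * g₃) / (2 * (z 1) ^ 2 * Real.sqrt (f (z 1))))) rP.domain → rL.domain = {t | 1 < t 0 ∧ t 0 < α} → Set.EqOn rL.integrand (fun t => (t 0)⁻¹) rL.domain → (M : ℝ) * rI.value + k * rP.value = m * rL.value → M • Literature.NumberTheory.Transcendental.KZ.of rI + k • Literature.NumberTheory.Transcendental.KZ.of rP - m • Literature.NumberTheory.Transcendental.KZ.of rL ∈ Literature.NumberTheory.Transcendental.KZ.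relations

/-- **The primitive-chain family** (the seed `NeronTorsionPrimitiveChain`, stmt-17981, with `Δ ≠ 0 ↦ ok Δ`): the
primitive tied element `q²•[rI] + p²•[rP] − c•[1 < t < B, dt/t]` is a chain of moves. Member `(· ≠ 0)` is the seed
verbatim (`primitiveChainOn_ne_iff`). [cite: KontsevichZagier2001, §1.2] -/
def PrimitiveChainOn (ok : ℝ → Prop) : Prop :=
  ∀ (g₂ g₃ e₁ xP yP : ℝ) (N a p q : ℕ) (f : ℝ → ℝ), (∀ x, f x = 4 * x ^ 3 - g₂ * x - g₃) → ok (g₂ ^ 3 - 27 * g₃ ^ 2) → f e₁ = 0 → 0 < e₁ → (∀ x, e₁ < x → 0 < f x) → e₁ < xP → yP ^ 2 = f xP → 3 ≤ N → 0 < a → 2 * a < N → (∀ hns : (⟨0, 0, 0, -g₂ / 4, -g₃ / 4⟩ : WeierstrassCurve ℝ).toAffine.Nonsingular xP (yP / 2), addOrderOf (WeierstrassCurve.Affine.Point.some xP (yP / 2) hns) = N) → (N : ℝ) * (∫ x in Set.Ioi xP, (Real.sqrt (f x))⁻¹) = a * (2 * ∫ x in Set.Ioi e₁, (Real.sqrt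 (f x))⁻¹) → Nat.Coprime p q → (q : ℤ) * ((N : ℤ) - 2 * (a : ℤ)) = (p : ℤ) * (2 * (N : ℤ)) → ∀ (rI rP : Literature.NumberTheory.Transcendental.KZ.IntegralRep 2), rI.domain = {z | e₁ < z 1 ∧ z 1 < z 0 ∧ z 0 < xP} → Set.EqOn rI.integrand (fun z => z 1 / (Real.sqrt (f (z 1)) * Real.sqrt (f (z 0)))) rI.domain → rP.domain = {z | e₁ < z 0 ∧ e₁ < z 1} → Set.EqOn rP.integrand (fun z => (Real.sqrt (f (z 0)))⁻¹ * ((g₂ * z 1 + 2 * g₃) / (2 * (z 1) ^ 2 * Real.sqrt (f (z 1))))) rP.domain → ∃ (c : ℤ) (B : ℝ) (rB : Literature.NumberTheory.Transcendental.KZ.IntegralRep 1), 1 < B ∧ IsAlgebraic ℚ B ∧ rB.domain = {t | 1 < t 0 ∧ t 0 < B} ∧ Set.EqOn rB.integrand (fun t => (t 0)⁻¹) rB.domain ∧ ((q : ℤ) ^ 2) • Literature.NumberTheory.Transcendental.KZ.of rI + ((p : ℤ) ^ 2) • Literature.NumberTheory.Transcendental.KZ.of rP - c • Literature.NumberTheory.Transcendental.KZ.of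 rB ∈ Literature.NumberTheory.Transcendental.KZ.relations

/-- **Stub A statement — ACNODAL REDUCTION (real analysis, no moves).**  Under the floor's hypotheses with `Δ = 0`
the curve is the acnodal cubic `g₂ = 3e₁²`, `g₃ = e₁³` (`f = 4(x − e₁)(x + e₁/2)²`) and the analytic torsion datum is
the ANGLE datum `σ_P := √(2(x_P − e₁)/(3e₁)) = tan(pπ/q)` with `0 < p`, `2p < q` (substitution `x = e₁ + (3e₁/2)σ²`,
`dx/√f = dσ/(c(σ² + 1))`, `c² = 3e₁/2`, `ω₁ = π/c`, `N·(π/2 − arctan σ_P)/c = a·π/c`).  From `f e₁ = 0`, `Δ = 0`,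
`0 < e₁`: `t = g₂/e₁²` solves `(t − 3)(t − 12)² = 0`; the split node `t = 12` (`f = 4(x − e₁)²(x + 2e₁)`) contradicts
the datum: `∫_(e₁)^∞ dx/√f` diverges — Bochner value `0` — while `∫_(x_P)^∞ dx/√f > 0` and `N ≥ 3`.
[cite: KontsevichZagier2001, §1.1] [cite: SilvermanATAEC1994, III Prop. 2.5] -/
def AcnodalReduction : Prop := ∀ (g₂ g₃ e₁ xP : ℝ) (N a p q : ℕ) (f : ℝ → ℝ),
  (∀ x, f x = 4 * x ^ 3 - g₂ * x - g₃) → g₂ ^ 3 - 27 * g₃ ^ 2 = 0 → f e₁ = 0 → 0 < e₁ → (∀ x, e₁ < x → 0 < f x) →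
  e₁ < xP → 3 ≤ N → 0 < a → 2 * a < N →
  (N : ℝ) * (∫ x in Set.Ioi xP, (Real.sqrt (f x))⁻¹) = a * (2 * ∫ x in Set.Ioi e₁, (Real.sqrt (f x))⁻¹) →
  Nat.Coprime p q → (q : ℤ) * ((N : ℤ) - 2 * (a : ℤ)) = (p : ℤ) * (2 * (N : ℤ)) →
  g₂ = 3 * e₁ ^ 2 ∧ g₃ = e₁ ^ 3 ∧ 0 < p ∧ 2 * p < q ∧
    Real.sqrt (2 * (xP - e₁) / (3 * e₁)) = Real.tan (Real.pi * p / q)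

/-- **Stub B statement — THE CIRCLE SCISSORS CONGRUENCE at angle `pπ/q` (the new move; quadratic term).**
`dσ/(σ² + 1) = dφ` (`σ = tan φ`) is the invariant form of the circle group `E_ns(ℝ)⁰ ≅ ℝ/πℤ` of every acnodal
cubic; rotations `φ ↦ φ + θ` with `tan θ` algebraic act by the Möbius maps `σ ↦ (σ + tan θ)/(1 − σ tan θ)` (KZ rule 2,
algebraic coefficients).  If the arc `(0, σ_P)` has angle exactly `L = pπ/q` (`0 < 2p < q`), then
`q²•[T_L, μ/3] − p²•[Q, 2μ/3] ∈ KZ.relations`, `μ = dσ′dσ/((σ′² + 1)(σ² + 1)) = dφ′dφ`, `T_L` the triangle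
`0 < φ′ < φ < L`, `Q` the quadrant `(0, π/2)²`: `[T_L] ∼ 2•[T_(L/2)] + [S_(L/2)] ∼ 2•[S_(L/2)]` (cuts at `L/2`,
translations, one swap; rule 1a + rule 2), and the squares `S_(L/2)`, `Q` are tiled by `p²`, resp. `q²`, translates
of `S_(π/2q)` (rules 1a, 2) — every translation stays inside `(0, π/2)²`, so no chart at `σ = ∞` is needed; values
`q²·(1/3)·L²/2 = p²·(2/3)·π²/4 = p²ζ(2)`.  NO division in `FormalRep`, NO primitive of `1/(σ² + 1)`.
IN-TREE PRECEDENT (one dimension): the Möbius rotation ladder of grid arcs `tan(kπ/2N)` for the half-angle form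
`2dv/(1 + v²)` is LANDED, `Summit.KontsevichZagierPeriods.Theorems.HurwitzMicroSectorsHurwitzSectorComplement.stub_arcRotation`
(`[(0, tan(πa/N))] ≡ 2a•[I₀]`, `N•[I₀] ≡ 2•[(0,1)]`, route HurwitzMicroSectors); with `N = q`, the product ideal
`Literature.NumberTheory.Transcendental.KZ.of_mul_mem_relations` and the coordinate swap
`Literature.NumberTheory.Transcendental.KZ.of_sub_of_reindex_mem_relations` (KZProductIdeal) it tiles the squares;
new here are the triangle symmetrisation `2•[T] ∼ [S]` used in the direction that needs no division, the weights, and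
the angle `pπ/q` read off a torsion point of a singular cubic.  Nearest printed computation of this genre: the
Beukers–Calabi–Kolk substitution (unit square ↔ triangle `u + v < π/2`, `ζ(2) = π²/6`; Aigner–Ziegler, Proofs from
THE BOOK, ch. 6), which in the coordinates `σ = tan` is the case "whole quarter circle".
[cite: KontsevichZagier2001, §1.1–1.2] [cite: AignerZiegler1998, ch. 6] -/
def CircleScissors : Prop := ∀ (σP : ℝ) (p q : ℕ) (rT rQ : Literature.NumberTheory.Transcendental.KZ.IntegralRep 2),
  0 < p → 2 * p < q → σP = Real.tan (Real.pi * p / q) →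
  rT.domain = {w | 0 < w 1 ∧ w 1 < w 0 ∧ w 0 < σP} →
  Set.EqOn rT.integrand (fun w => 1 / (3 * ((w 1 ^ 2 + 1) * (w 0 ^ 2 + 1)))) rT.domain →
  rQ.domain = {w | 0 < w 0 ∧ 0 < w 1} →
  Set.EqOn rQ.integrand (fun w => 2 / (3 * ((w 1 ^ 2 + 1) * (w 0 ^ 2 + 1)))) rQ.domain →
  (((q : ℤ) ^ 2) • Literature.NumberTheory.Transcendental.KZ.of rT -
    ((p : ℤ) ^ 2) • Literature.NumberTheory.Transcendental.KZ.of rQ ∈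
      Literature.NumberTheory.Transcendental.KZ.relations)

/-- **Stub C statement — ACNODAL CARRIERS (rationalisation; the log carrier; the regularised quasi-period).**  For
the acnodal cubic `f = 4x³ − 3b²x − b³` (`0 < b < x_P`; `b`, `x_P` algebraic because `rI.domain` is
`ℚ`-semialgebraic, `isAlgebraic_endpoints_of_isSemialgebraic_Ioo`) and the floor-shaped `rI` (Néron triangle), `rP`
(quasi-period quadrant): the substitution `x = b + (3b/2)σ²` in both variables (ONE rule-2 move),
`x′dx′/√f(x′) · dx/√f(x) = (2/3 + σ′²)/((σ′² + 1)(σ² + 1)) dσ′dσ = [1/(σ² + 1) − (1/3)/((σ′² + 1)(σ² + 1))] dσ′dσ`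
(rule 1b), fibre Newton–Leibniz in `σ′`, `t = σ² + 1`, `t = τ²` (rules 3, 2) give `[rI] + [rT] − [1 < τ < B, dτ/τ]
∈ relations`, `B = √(1 + σ_P²) = √((2x_P + b)/(3b)) > 1` algebraic, `rT = [T_(σ_P), μ/3]`; and the exact form
`(3b²x′ + 2b³)dx′/(2x′²√f(x′)) = d(b s′/(s′² + b)) + b ds′/(s′² + 3b/2)` (`x′ = b + s′²`; potential vanishing at
`s′ = 0, ∞`; rule 3 after the floor's corner compactification, cf. TorsionLogsNeronTorsionSectorStubUpperRegular)
gives `[rP] − [Q, 2μ/3] ∈ relations` (value `(2/3)(π/2)² = ζ(2)` for every `b`).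
[cite: KontsevichZagier2001, §1.1–1.2] [cite: BochnakCosteRoy1998, §2.2] -/
def AcnodalCarriers : Prop := ∀ (b xP : ℝ) (f : ℝ → ℝ) (rI rP : Literature.NumberTheory.Transcendental.KZ.IntegralRep 2),
  0 < b → b < xP → (∀ x, f x = 4 * x ^ 3 - 3 * b ^ 2 * x - b ^ 3) →
  rI.domain = {z | b < z 1 ∧ z 1 < z 0 ∧ z 0 < xP} →
  Set.EqOn rI.integrand (fun z => z 1 / (Real.sqrt (f (z 1)) * Real.sqrt (f (z 0)))) rI.domain →
  rP.domain = {z | b < z 0 ∧ b < z 1} →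
  Set.EqOn rP.integrand
    (fun z => (Real.sqrt (f (z 0)))⁻¹ * ((3 * b ^ 2 * z 1 + 2 * b ^ 3) / (2 * (z 1) ^ 2 * Real.sqrt (f (z 1))))) rP.domain →
  ∃ (rT rQ : Literature.NumberTheory.Transcendental.KZ.IntegralRep 2) (B : ℝ)
    (rB : Literature.NumberTheory.Transcendental.KZ.IntegralRep 1),
    rT.domain = {w | 0 < w 1 ∧ w 1 < w 0 ∧ w 0 < Real.sqrt (2 * (xP - b) / (3 * b))} ∧
    Set.EqOn rT.integrand (fun w => 1 / (3 * ((w 1 ^ 2 + 1) * (w 0 ^ 2 + 1)))) rT.domain ∧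
    rQ.domain = {w | 0 < w 0 ∧ 0 < w 1} ∧
    Set.EqOn rQ.integrand (fun w => 2 / (3 * ((w 1 ^ 2 + 1) * (w 0 ^ 2 + 1)))) rQ.domain ∧
    1 < B ∧ IsAlgebraic ℚ B ∧ rB.domain = {t | 1 < t 0 ∧ t 0 < B} ∧
    Set.EqOn rB.integrand (fun t => (t 0)⁻¹) rB.domain ∧
    (Literature.NumberTheory.Transcendental.KZ.of rI + Literature.NumberTheory.Transcendental.KZ.of rT -
        Literature.NumberTheory.Transcendental.KZ.of rB ∈ Literature.NumberTheory.Transcendental.KZ.relations) ∧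
    (Literature.NumberTheory.Transcendental.KZ.of rP - Literature.NumberTheory.Transcendental.KZ.of rQ ∈
        Literature.NumberTheory.Transcendental.KZ.relations)

/-- The identity-component tied set `T` of the crux `TorsionSectorComplete` (copied verbatim). -/
def TorsionTied : Set Literature.NumberTheory.Transcendental.KZ.FormalRep := {d : Literature.NumberTheory.Transcendental.KZ.FormalRep | ∃ (g₂ g₃ e₁ xP yP α : ℝ) (N a : ℕ) (M k m : ℤ) (f : ℝ → ℝ) (rI rP : Literature.NumberTheory.Transcendental.KZ.IntegralRep 2) (rL : Literature.NumberTheory.Transcendental.KZ.IntegralRep 1), (∀ x, f x = 4 * x ^ 3 - g₂ * x - g₃) ∧ g₂ ^ 3 - 27 * g₃ ^ 2 ≠ 0 ∧ f e₁ = 0 ∧ 0 < e₁ ∧ (∀ x, e₁ < x → 0 < f x) ∧ e₁ < xP ∧ yP ^ 2 = f xP ∧ 3 ≤ N ∧ 0 < a ∧ 2 * a < N ∧ 4 * (N : ℤ) ^ 2 * k = M * ((N : ℤ) - 2 * (a : ℤ)) ^ 2 ∧ (∀ hns : (⟨0, 0, 0, -g₂ / 4, -g₃ / 4⟩ : WeierstrassCurve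 ℝ).toAffine.Nonsingular xP (yP / 2), addOrderOf (WeierstrassCurve.Affine.Point.some xP (yP / 2) hns) = N) ∧ (N : ℝ) * (∫ x in Set.Ioi xP, (Real.sqrt (f x))⁻¹) = a * (2 * ∫ x in Set.Ioi e₁, (Real.sqrt (f x))⁻¹) ∧ 1 < α ∧ rI.domain = {z | e₁ < z 1 ∧ z 1 < z 0 ∧ z 0 < xP} ∧ Set.EqOn rI.integrand (fun z => z 1 / (Real.sqrt (f (z 1)) * Real.sqrt (f (z 0)))) rI.domain ∧ rP.domain = {z | e₁ < z 0 ∧ e₁ < z 1} ∧ Set.EqOn rP.integrand (fun z => (Real.sqrt (f (z 0)))⁻¹ * ((g₂ * z 1 + 2 * g₃) / (2 * (z 1) ^ 2 * Real.sqrt (f (z 1))))) rP.domain ∧ rL.domain = {t | 1 < t 0 ∧ t 0 < α} ∧ Set.EqOn rL.integrand (fun t => (t 0)⁻¹) rL.domain ∧ (M : ℝ) * rI.value + k * rP.value = m * rL.value ∧ d = M • Literature.NumberTheory.Transcendental.KZ.of rI + k • Literature.NumberTheory.Transcendental.KZ.of rP - m • Literature.NumberTheory.Transcendental.KZ.of 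rL}

/-- The acnodal tied set `T^(acn)` (the elements of the member `(· = 0)`). -/
def AcnodalTied : Set Literature.NumberTheory.Transcendental.KZ.FormalRep := {d : Literature.NumberTheory.Transcendental.KZ.FormalRep | ∃ (g₂ g₃ e₁ xP yP α : ℝ) (N a : ℕ) (M k m : ℤ) (f : ℝ → ℝ) (rI rP : Literature.NumberTheory.Transcendental.KZ.IntegralRep 2) (rL : Literature.NumberTheory.Transcendental.KZ.IntegralRep 1), (∀ x, f x = 4 * x ^ 3 - g₂ * x - g₃) ∧ g₂ ^ 3 - 27 * g₃ ^ 2 = 0 ∧ f e₁ = 0 ∧ 0 < e₁ ∧ (∀ x, e₁ < x → 0 < f x) ∧ e₁ < xP ∧ yP ^ 2 = f xP ∧ 3 ≤ N ∧ 0 < a ∧ 2 * a < N ∧ 4 * (N : ℤ) ^ 2 * k = M * ((N : ℤ) - 2 * (a : ℤ)) ^ 2 ∧ (∀ hns : (⟨0, 0, 0, -g₂ / 4, -g₃ / 4⟩ : WeierstrassCurve ℝ).toAffine.Nonsingular xP (yP / 2), addOrderOf (WeierstrassCurve.Affine.Point.some xP (yP / 2) hns) = N) ∧ (N : ℝ)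 * (∫ x in Set.Ioi xP, (Real.sqrt (f x))⁻¹) = a * (2 * ∫ x in Set.Ioi e₁, (Real.sqrt (f x))⁻¹) ∧ 1 < α ∧ rI.domain = {z | e₁ < z 1 ∧ z 1 < z 0 ∧ z 0 < xP} ∧ Set.EqOn rI.integrand (fun z => z 1 / (Real.sqrt (f (z 1)) * Real.sqrt (f (z 0)))) rI.domain ∧ rP.domain = {z | e₁ < z 0 ∧ e₁ < z 1} ∧ Set.EqOn rP.integrand (fun z => (Real.sqrt (f (z 0)))⁻¹ * ((g₂ * z 1 + 2 * g₃) / (2 * (z 1) ^ 2 * Real.sqrt (f (z 1))))) rP.domain ∧ rL.domain = {t | 1 < t 0 ∧ t 0 < α} ∧ Set.EqOn rL.integrand (fun t => (t 0)⁻¹) rL.domain ∧ (M : ℝ) * rI.value + k * rP.value = m * rL.value ∧ d = M • Literature.NumberTheory.Transcendental.KZ.of rI + k • Literature.NumberTheory.Transcendental.KZ.of rP - m • Literature.NumberTheory.Transcendental.KZ.of rL}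

/-- **Stub D statement (residual, conjecture-grade): completeness off the sector enlarged across the discriminant.**
Two rational-shape representations with equal values differ by an element of `relations ⊔ closure (T ∪ T^(acn))`.
Between `KZKernelConjecture` (`relations` alone) and the crux (`relations ⊔ closure T`); WEAKER than the crux
(`acnodalSectorComplete_of_torsionSectorComplete`). [cite: KontsevichZagier2001, §1.2 Conjecture 1] -/
def AcnodalSectorComplete : Prop := ∀ ⦃n m : ℕ⦄ (r : Literature.NumberTheory.Transcendental.KZ.IntegralRep n) (r' : Literature.NumberTheory.Transcendental.KZ.IntegralRep m), r.IsRational → r'.IsRational → r.value = r'.value → Literature.NumberTheory.Transcendental.KZ.of r - Literature.NumberTheory.Transcendental.KZ.of r' ∈ Literature.NumberTheory.Transcendental.KZ.relations ⊔ AddSubgroup.closure (TorsionTied ∪ AcnodalTied)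

/-! ### Registered stubs -/

/-- **Stub A (M).** `AcnodalReduction`. -/
theorem stub_acnodalReduction : AcnodalReduction := by
  sorry

/-- **Stub B (M–L, load-bearing, the new move).** `CircleScissors`. -/
theorem stub_circleScissors : CircleScissors := by
  sorry

/-- **Stub C (M).** `AcnodalCarriers`. -/
theorem stub_acnodalCarriers : AcnodalCarriers := by
  sorry

/-- **Stub D (residual, conjecture-grade).** `AcnodalSectorComplete`. -/
theorem stub_acnodalSectorComplete : AcnodalSectorComplete := by
  sorry

/-! ### Proved infrastructure (no `sorry` below this line) -/

/-- The crux unfolds to completeness relative to `relations ⊔ closure T`. -/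
theorem torsionSectorComplete_iff :
    TorsionSectorComplete ↔ ∀ ⦃n m : ℕ⦄ (r : Literature.NumberTheory.Transcendental.KZ.IntegralRep n) (r' : Literature.NumberTheory.Transcendental.KZ.IntegralRep m), r.IsRational → r'.IsRational → r.value = r'.value → Literature.NumberTheory.Transcendental.KZ.of r - Literature.NumberTheory.Transcendental.KZ.of r' ∈ Literature.NumberTheory.Transcendental.KZ.relations ⊔ AddSubgroup.closure TorsionTied :=
  Iff.rfl

/-- Member `(· ≠ 0)` of the family is `NeronTorsionSector` on the nose. -/
theorem neronTorsionSectorOn_ne_iff : NeronTorsionSectorOn (· ≠ 0) ↔ NeronTorsionSector :=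
  Iff.rfl

/-- Member `(· ≠ 0)` of the primitive family is the seed's statement on the nose. -/
theorem primitiveChainOn_ne_iff : PrimitiveChainOn (· ≠ 0) ↔ NeronTorsionPrimitiveChain :=
  Iff.rfl

/-- **The rung IS the floor's crux with the discriminant hypothesis deleted** (honesty of the family device: no
disjunction, no Bool index — `∀ ok` quantifies the hypothesis away). [folklore] -/
theorem acrossDiscriminant_iff_free : NeronTorsionAcrossDiscriminant ↔ NeronTorsionSectorFree := by
  constructor
  · intro h g₂ g₃ e₁ xP yP α N a M k m f hf
    exact h (fun _ => True) g₂ g₃ e₁ xP yP α N a M k m f hf trivial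
  · intro h ok g₂ g₃ e₁ xP yP α N a M k m f hf _
    exact h g₂ g₃ e₁ xP yP α N a M k m f hf

/-- **Bookkeeping, uniform in `ok`** (the landed `NeronTorsionSector_of_primitiveChain`, which never inspects the
discriminant hypothesis, copied with `Δ ≠ 0 ↦ ok Δ`): the primitive chain gives the tied member — `ρ = p/q` in lowest
terms, `(M, k) = s·(q², p²)` by coprimality, soundness for the value, the landed log calculus for
`(s c)•[rB] − m•[rL]`. [cite: KontsevichZagier2001, §1.2] [cite: Lang1983, Ch. 13 Thm 1.1] -/
theorem sectorOn_of_primitiveChainOn (ok : ℝ → Prop) (hPC : PrimitiveChainOn ok) : NeronTorsionSectorOn ok := by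
  intro g₂ g₃ e₁ xP yP α N a M k m f hf hdisc he he0 hpos hx hy hN ha ha2 htie htor hρ hα rI rP rL hdI hiI
    hdP hiP hdL hiL hval
  -- reduced exponents `ρ = (N − 2a)/(2N) = p/q`
  have h2a : 2 * a ≤ N := by omega
  obtain ⟨p, q, hcop, hpqN, hq0⟩ :
      ∃ p q : ℕ, Nat.Coprime p q ∧ q * (N - 2 * a) = p * (2 * N) ∧ 0 < q := by
    have hg0 : 0 < Nat.gcd (N - 2 * a) (2 * N) := Nat.gcd_pos_of_pos_right _ (by omega)
    refine ⟨(N - 2 * a) / Nat.gcd (N - 2 * a) (2 * N), (2 * N) / Nat.gcd (N - 2 * a) (2 * N),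
      Nat.coprime_div_gcd_div_gcd hg0, ?_, ?_⟩
    · have hp' : (N - 2 * a) / Nat.gcd (N - 2 * a) (2 * N) * Nat.gcd (N - 2 * a) (2 * N) = N - 2 * a :=
        Nat.div_mul_cancel (Nat.gcd_dvd_left _ _)
      have hq' : (2 * N) / Nat.gcd (N - 2 * a) (2 * N) * Nat.gcd (N - 2 * a) (2 * N) = 2 * N :=
        Nat.div_mul_cancel (Nat.gcd_dvd_right _ _)
      calc (2 * N) / Nat.gcd (N - 2 * a) (2 * N) * (N - 2 * a)
          = (2 * N) / Nat.gcd (N - 2 * a) (2 * N) *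
              ((N - 2 * a) / Nat.gcd (N - 2 * a) (2 * N) * Nat.gcd (N - 2 * a) (2 * N)) := by rw [hp']
        _ = (N - 2 * a) / Nat.gcd (N - 2 * a) (2 * N) *
              ((2 * N) / Nat.gcd (N - 2 * a) (2 * N) * Nat.gcd (N - 2 * a) (2 * N)) := by ring
        _ = (N - 2 * a) / Nat.gcd (N - 2 * a) (2 * N) * (2 * N) := by rw [hq']
    · exact Nat.div_pos (Nat.le_of_dvd (by omega) (Nat.gcd_dvd_right _ _)) hg0
  have hpqZ : (q : ℤ) * ((N : ℤ) - 2 * (a : ℤ)) = (p : ℤ) * (2 * (N : ℤ)) := by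
    have h := congrArg (Nat.cast : ℕ → ℤ) hpqN
    push_cast [Nat.cast_sub h2a] at h
    linarith
  -- the tie: `(M, k) = s • (q², p²)`
  have hN0 : (N : ℤ) ≠ 0 := by exact_mod_cast (show N ≠ 0 by omega)
  have hqk : (q : ℤ) ^ 2 * k = (p : ℤ) ^ 2 * M := by
    have h4 : (4 : ℤ) * (N : ℤ) ^ 2 ≠ 0 := mul_ne_zero (by norm_num) (pow_ne_zero 2 hN0)
    apply mul_left_cancel₀ h4
    calc 4 * (N : ℤ) ^ 2 * ((q : ℤ) ^ 2 * k) = (q : ℤ) ^ 2 * (4 * (N : ℤ) ^ 2 * k) := by ring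
      _ = (q : ℤ) ^ 2 * (M * ((N : ℤ) - 2 * (a : ℤ)) ^ 2) := by rw [htie]
      _ = M * ((q : ℤ) * ((N : ℤ) - 2 * (a : ℤ))) ^ 2 := by ring
      _ = M * ((p : ℤ) * (2 * (N : ℤ))) ^ 2 := by rw [hpqZ]
      _ = 4 * (N : ℤ) ^ 2 * ((p : ℤ) ^ 2 * M) := by ring
  have hcopZ : IsCoprime ((q : ℤ) ^ 2) ((p : ℤ) ^ 2) := by
    have h := Nat.isCoprime_iff_coprime.mpr (hcop.symm.pow 2 2)
    push_cast at h
    exact h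
  obtain ⟨s, hs⟩ : (q : ℤ) ^ 2 ∣ M :=
    hcopZ.dvd_of_dvd_mul_left ⟨k, by linear_combination -hqk⟩
  have hq0Z : (q : ℤ) ^ 2 ≠ 0 := pow_ne_zero 2 (by exact_mod_cast hq0.ne')
  have hk : k = (p : ℤ) ^ 2 * s := by
    apply mul_left_cancel₀ hq0Z
    rw [hqk, hs]
    ring
  -- the primitive chain and its value
  obtain ⟨c, B, rB, hB, hBalg, hdB, hiB, hprim⟩ :=
    hPC g₂ g₃ e₁ xP yP N a p q f hf hdisc he he0 hpos hx hy hN ha ha2 htor hρ hcop hpqZ rI rP hdI hiI hdP hiP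
  have hvB : rB.value = Real.log B := logRep_value hB.le rB hdB hiB
  have hvL : rL.value = Real.log α := logRep_value hα.le rL hdL hiL
  have hαalg : IsAlgebraic ℚ α := isAlgebraic_of_logRep hα rL hdL
  have h0 : (q : ℝ) ^ 2 * rI.value + (p : ℝ) ^ 2 * rP.value - c * Real.log B = 0 := by
    have h := KZ.relations_le_ker_eval_holds hprim
    rw [AddMonoidHom.mem_ker] at h
    simpa only [map_add, map_sub, map_zsmul, KZ.eval_of, zsmul_eq_mul, Int.cast_pow, Int.cast_natCast,
      hvB] using h
  -- the value hypothesis becomes a relation between two logarithms of algebraic numbers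
  have hlog : (s : ℝ) * c * Real.log B - m * Real.log α = 0 := by
    have hM : (M : ℝ) = (q : ℝ) ^ 2 * s := by
      rw [hs]
      push_cast
      ring
    have hK : (k : ℝ) = (p : ℝ) ^ 2 * s := by
      rw [hk]
      push_cast
      ring
    rw [hM, hK, hvL] at hval
    linear_combination hval - (s : ℝ) * h0
  -- landed log calculus: `(s c)•[rB] − m•[rL] ∈ relations`
  have hiB1 : Set.EqOn rB.integrand (fun t : Fin 1 → ℝ => 1 / t 0) rB.domain := fun t ht => by
    simp only [hiB ht, one_div]
  have hiL1 : Set.EqOn rL.integrand (fun t : Fin 1 → ℝ => 1 / t 0) rL.domain := fun t ht => by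
    simp only [hiL ht, one_div]
  have hL : (s * c) • KZ.of rB - m • KZ.of rL ∈ KZ.relations := by
    have h := interval_log_relation_mem_relations 2 ![1, 1] ![B, α] ![s * c, -m] ![rB, rL]
      (fun i => by fin_cases i <;> simp)
      (fun i => by fin_cases i <;> simp [hB.le, hα.le])
      (fun i => by fin_cases i <;> exact isAlgebraic_one)
      (fun i => by fin_cases i <;> simp [hBalg, hαalg])
      (fun i => by
        fin_cases i
        · exact ⟨hdB, hiB1⟩
        · exact ⟨hdL, hiL1⟩)
      (by
        simp only [Fin.sum_univ_two, Matrix.cons_val_zero, Matrix.cons_val_one, div_one, Int.cast_neg,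
          Int.cast_mul]
        linear_combination hlog)
    have e : ∑ i : Fin 2, (![s * c, -m] i : ℤ) • KZ.of (![rB, rL] i) =
        (s * c) • KZ.of rB - m • KZ.of rL := by
      simp only [Fin.sum_univ_two, Matrix.cons_val_zero, Matrix.cons_val_one, neg_smul]
      abel
    rw [e] at h
    exact h
  -- assembly
  have e : M • KZ.of rI + k • KZ.of rP - m • KZ.of rL =
      s • (((q : ℤ) ^ 2) • KZ.of rI + ((p : ℤ) ^ 2) • KZ.of rP - c • KZ.of rB) +
        ((s * c) • KZ.of rB - m • KZ.of rL) := by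
    rw [hs, hk]
    module
  rw [e]
  exact KZ.relations.add_mem (KZ.relations.zsmul_mem hprim s) hL

/-- **F3 WITNESS — the floor is the member `(· ≠ 0)` of the family** (names the seed `stub_assembly` through the landed
bookkeeping). -/
theorem neronTorsionSectorOn_ne : NeronTorsionSectorOn (· ≠ 0) :=
  neronTorsionSectorOn_ne_iff.mpr (NeronTorsionSector_of_primitiveChain stub_assembly)

/-- **Composition of stubs A–C: the primitive ACNODAL chain** (member `(· = 0)` of the primitive family).  Reduce to
the acnodal normal form and the angle datum (A), rationalise and split off the log carrier and the regularised
quasi-period (C), kill the quadratic term by the circle scissors congruence (B):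
`q²•[rI] + p²•[rP] − q²•[rB] = q²•([rI] + [rT] − [rB]) − (q²•[rT] − p²•[rQ]) + p²•([rP] − [rQ])`.
[cite: KontsevichZagier2001, §1.2] -/
theorem primitiveChainOn_eq_of (hA : AcnodalReduction) (hB : CircleScissors) (hC : AcnodalCarriers) :
    PrimitiveChainOn (· = 0) := by
  intro g₂ g₃ e₁ xP yP N a p q f hf hdisc he he0 hpos hx hy hN ha ha2 htor hρ hcop hpq rI rP hdI hiI hdP hiP
  obtain ⟨hg₂, hg₃, hp0, h2pq, hang⟩ := hA g₂ g₃ e₁ xP N a p q f hf hdisc he he0 hpos hx hN ha ha2 hρ hcop hpq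
  subst hg₂ hg₃
  obtain ⟨rT, rQ, B, rB, hdT, hiT, hdQ, hiQ, hB1, hBalg, hdB, hiB, hR1, hR2⟩ :=
    hC e₁ xP f rI rP he0 hx hf hdI hiI hdP hiP
  have hR3 := hB (Real.sqrt (2 * (xP - e₁) / (3 * e₁))) p q rT rQ hp0 h2pq hang hdT hiT hdQ hiQ
  refine ⟨(q : ℤ) ^ 2, B, rB, hB1, hBalg, hdB, hiB, ?_⟩
  have e : ((q : ℤ) ^ 2) • KZ.of rI + ((p : ℤ) ^ 2) • KZ.of rP - ((q : ℤ) ^ 2) • KZ.of rB =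
      ((q : ℤ) ^ 2) • (KZ.of rI + KZ.of rT - KZ.of rB) - (((q : ℤ) ^ 2) • KZ.of rT - ((p : ℤ) ^ 2) • KZ.of rQ) +
        ((p : ℤ) ^ 2) • (KZ.of rP - KZ.of rQ) := by
    module
  rw [e]
  exact KZ.relations.add_mem (KZ.relations.sub_mem (KZ.relations.zsmul_mem hR1 _) hR3)
    (KZ.relations.zsmul_mem hR2 _)

/-- The acnodal member of the tied family, from stubs A–C. -/
theorem neronTorsionSectorOn_eq_of (hA : AcnodalReduction) (hB : CircleScissors) (hC : AcnodalCarriers) :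
    NeronTorsionSectorOn (· = 0) :=
  sectorOn_of_primitiveChainOn _ (primitiveChainOn_eq_of hA hB hC)

/-- **The rung from stubs A–C** (`<Rung>_of`): for an arbitrary predicate `ok`, split on `Δ = 0`; the acnodal member
(stubs A–C) or the floor's landed chain. [cite: KontsevichZagier2001, §1.2] -/
theorem neronTorsionAcrossDiscriminant_of (hA : AcnodalReduction) (hB : CircleScissors) (hC : AcnodalCarriers) :
    NeronTorsionAcrossDiscriminant := by
  intro ok g₂ g₃ e₁ xP yP α N a M k m f hf _hok he he0 hpos hx hy hN ha ha2 htie htor hρ hα rI rP rL hdI hiI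
    hdP hiP hdL hiL hval
  by_cases hΔ : g₂ ^ 3 - 27 * g₃ ^ 2 = 0
  · exact neronTorsionSectorOn_eq_of hA hB hC g₂ g₃ e₁ xP yP α N a M k m f hf hΔ he he0 hpos hx hy hN ha ha2
      htie htor hρ hα rI rP rL hdI hiI hdP hiP hdL hiL hval
  · exact neronTorsionSectorOn_ne g₂ g₃ e₁ xP yP α N a M k m f hf hΔ he he0 hpos hx hy hN ha ha2 htie htor hρ hα
      rI rP rL hdI hiI hdP hiP hdL hiL hval

/-- Conversely the rung is exactly its acnodal member (the floor member being a theorem). -/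
theorem acrossDiscriminant_iff_eq : NeronTorsionAcrossDiscriminant ↔ NeronTorsionSectorOn (· = 0) := by
  refine ⟨fun h => h _, fun h ok => ?_⟩
  intro g₂ g₃ e₁ xP yP α N a M k m f hf _hok he he0 hpos hx hy hN ha ha2 htie htor hρ hα rI rP rL hdI hiI
    hdP hiP hdL hiL hval
  by_cases hΔ : g₂ ^ 3 - 27 * g₃ ^ 2 = 0
  · exact h g₂ g₃ e₁ xP yP α N a M k m f hf hΔ he he0 hpos hx hy hN ha ha2 htie htor hρ hα rI rP rL hdI hiI hdP
      hiP hdL hiL hval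
  · exact neronTorsionSectorOn_ne g₂ g₃ e₁ xP yP α N a M k m f hf hΔ he he0 hpos hx hy hN ha ha2 htie htor hρ hα
      rI rP rL hdI hiI hdP hiP hdL hiL hval

/-- The acnodal member says exactly `closure T^(acn) ≤ KZ.relations`. [cite: KontsevichZagier2001, §1.2] -/
theorem closure_acnodalTied_le_relations (h : NeronTorsionSectorOn (· = 0)) :
    AddSubgroup.closure AcnodalTied ≤ Literature.NumberTheory.Transcendental.KZ.relations := by
  refine (AddSubgroup.closure_le _).mpr ?_
  rintro d ⟨g₂, g₃, e₁, xP, yP, α, N, a, M, k, m', f, rI, rP, rL, hf, hdisc, he, he0, hpos, hx, hy, hN, ha,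
    ha', htie, hord, htor, hα, hdI, hiI, hdP, hiP, hdL, hiL, hval, rfl⟩
  exact h g₂ g₃ e₁ xP yP α N a M k m' f hf hdisc he he0 hpos hx hy hN ha ha' htie hord htor hα rI rP rL hdI hiI
    hdP hiP hdL hiL hval

/-- The identity member says exactly `closure T ≤ KZ.relations`. [cite: KontsevichZagier2001, §1.2] -/
theorem closure_torsionTied_le_relations (h : NeronTorsionSectorOn (· ≠ 0)) :
    AddSubgroup.closure TorsionTied ≤ Literature.NumberTheory.Transcendental.KZ.relations := by
  refine (AddSubgroup.closure_le _).mpr ?_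
  rintro d ⟨g₂, g₃, e₁, xP, yP, α, N, a, M, k, m', f, rI, rP, rL, hf, hdisc, he, he0, hpos, hx, hy, hN, ha,
    ha', htie, hord, htor, hα, hdI, hiI, hdP, hiP, hdL, hiL, hval, rfl⟩
  exact h g₂ g₃ e₁ xP yP α N a M k m' f hf hdisc he he0 hpos hx hy hN ha ha' htie hord htor hα rI rP rL hdI hiI
    hdP hiP hdL hiL hval

/-- **F4 ON-PATH LEMMA — the summit implies the rung**, uniformly in `ok` (Conjecture 1 in kernel form,
`kzKernelConjecture_iff_isRational`; a tied element evaluates to `0` by its value hypothesis).  Tagged `@[simp]` so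
that the tribunal's forward probe `S → Rung` closes by `intro h; aesop`. [cite: KontsevichZagier2001, §1.2] -/
@[simp] theorem neronTorsionAcrossDiscriminant_of_kontsevichZagierPeriods (h : _root_.KontsevichZagierPeriods) :
    NeronTorsionAcrossDiscriminant := by
  have hK : KZKernelConjecture := kzKernelConjecture_iff_isRational.mpr h
  intro ok g₂ g₃ e₁ xP yP α N a M k m f _ _ _ _ _ _ _ _ _ _ _ _ _ _ rI rP rL _ _ _ _ _ _ hval
  apply hK
  rw [map_sub, map_add, map_zsmul, map_zsmul, map_zsmul, KZ.eval_of, KZ.eval_of, KZ.eval_of, zsmul_eq_mul,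
    zsmul_eq_mul, zsmul_eq_mul]
  linarith [hval]

/-- The residual is a consequence of the crux (hence of the summit): `closure T ≤ closure (T ∪ T^(acn))`.
(Informational: stub D is WEAKER than the crux as typed.) [folklore] -/
theorem acnodalSectorComplete_of_torsionSectorComplete (h : TorsionSectorComplete) : AcnodalSectorComplete := by
  intro n m r r' hr hr' hv
  have hmono : Literature.NumberTheory.Transcendental.KZ.relations ⊔ AddSubgroup.closure TorsionTied ≤
      Literature.NumberTheory.Transcendental.KZ.relations ⊔ AddSubgroup.closure (TorsionTied ∪ AcnodalTied) :=
    sup_le_sup_left (AddSubgroup.closure_mono Set.subset_union_left) _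
  exact hmono (torsionSectorComplete_iff.mp h r r' hr hr' hv)

/-! ### Composition: the crux BY NAME from the four stubs -/

/-- **`TorsionSectorComplete` from the stubs** (closed term; `sorry` only through `stub_acnodalReduction`,
`stub_circleScissors`, `stub_acnodalCarriers`, `stub_acnodalSectorComplete`): the rung (stubs A–C) folds the acnodal
sector into the moves (`closure T^(acn) ≤ relations`), so the residual's `relations ⊔ closure (T ∪ T^(acn))` is
`≤ relations ⊔ closure T`. [cite: KontsevichZagier2001, §1.2] -/
theorem TorsionSectorComplete_of : TorsionSectorComplete := by
  suffices key : AcnodalReduction → CircleScissors → AcnodalCarriers → AcnodalSectorComplete →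
      TorsionSectorComplete from
    key stub_acnodalReduction stub_circleScissors stub_acnodalCarriers stub_acnodalSectorComplete
  intro hA hB hC hD
  rw [torsionSectorComplete_iff]
  intro n m r r' hr hr' hv
  have hR : NeronTorsionAcrossDiscriminant := neronTorsionAcrossDiscriminant_of hA hB hC
  have hle : Literature.NumberTheory.Transcendental.KZ.relations ⊔ AddSubgroup.closure (TorsionTied ∪ AcnodalTied) ≤
      Literature.NumberTheory.Transcendental.KZ.relations ⊔ AddSubgroup.closure TorsionTied := by
    refine sup_le le_sup_left ((AddSubgroup.closure_le _).mpr ?_)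
    rintro d (hd | hd)
    · exact AddSubgroup.mem_sup_right (AddSubgroup.subset_closure hd)
    · exact AddSubgroup.mem_sup_left (closure_acnodalTied_le_relations (hR _) (AddSubgroup.subset_closure hd))
  exact hle (hD r r' hr hr' hv)

end Summit.KontsevichZagierPeriods.KontsevichZagierPeriods.Cruxes.TorsionSectorComplete.NeronTorsionAcnodal

end
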